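/-
Copyright (c) 2026 the pub-hodgecm-mathlib formalisation cell (harness21).  Prover seat hodgecm-mathlib-K2E2-p12 (g5): Track B «K2-LIT», ENGINE E1,
h413 = stmt-HodgeConjecture-24833; «EIS-WHITTAKER-3» W3₃ (W-asm) sub-brick (U3C-c1) «LOCAL WHITTAKER CHARACTERS AT THE CM PAIR» (dealer K2E1-plan (g5) 09:27:38Z (2)).
-/
import Summits.HodgeConjecture.HodgeConjecture.Theorems.K2E1IntertwiningLocalFactorU3Height   -- ★ (this seat): `quadraticLocalEquiv_apply_place`, letters `hcδ hδ hd`, `LocalRing`, `toPlace`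
import Literature.NumberTheory.Automorphic.AdelicAdditiveCharacterDuality                      -- ★ `eventually_exists_adeleAddCharAt_ne_one`, `adeleAddCharAt_eq_one_of_mem`
import Literature.NumberTheory.Automorphic.AdeleAddCharGaloisEquivariance                     -- ★ `adeleAddCharAt_galAdicCompletionMap` (`ψ_w ∘ σ_w = ψ_w`)
import Literature.NumberTheory.Automorphic.UnitaryGroupInertPlaceHyperbolicBasis               -- ★ `exists_toPlace_eq_of_galAdicCompletionMap_eq` (a `σ_w`-fixed element descends), `σ_w ∘ σ_w = id`
import Literature.NumberTheory.Automorphic.QuadraticAdeleBaseChange                           -- ★ `valued_toPlace_le_one_iff`, `eventually_forall_placesOver`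
import Literature.NumberTheory.Automorphic.AddCharConductorExponent                           -- ★ `mem_primePowBall_adicCompletion_iff`
import Literature.NumberTheory.Automorphic.TateLocalFactors                                    -- ★ `AddChar.HasConductorExp`
import Literature.NumberTheory.GelbartRogawski1991.LocalUnitarySplitPlaceDarboux                -- ★ `valued_toPlace_of_split`, `toPlace_splitCoord`
import Literature.NumberTheory.NumberFields.QuadraticCompletionIntegralBasis                    -- ★ `valued_toPlace_of_ramificationIdx'_eq_one`, `ramificationIdx'_eq_one_of_isUnramifiedIn`
import Literature.NumberTheory.GaloisRepresentations.FrobeniusDensityTheorem                  -- ★ `finite_setOf_not_isUnramifiedIn` (finitely many ramified places)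
import HarnessLib

/-!
# K2·E1 — `K2E1WhittakerLocalCharactersCM` («EIS-WHITTAKER-3» W3₃, (W-asm) sub-brick (U3C-c1)): THE LOCAL ADDITIVE CHARACTERS `χ_w = ψ_{L,w} ∘ ι_w` OF `L⁺_v` — continuity,
# triviality on `𝒪_v`, CONDUCTOR EXPONENT `0` AT ALMOST EVERY PLACE, and, at a non-split place, `ψ_{L,w}(ι_w(x)·δ_w) = 1` and `ψ_{L,w}(Ψ_v(a,b)_w·Ψ_v(p,q)_w) = χ_w(ap + dbq)`

Track B ∕ K2-LIT, crux h413 = `stmt-HodgeConjecture-24833`, route of record `HCCMUnconditional`; cell `hodgecm-mathlib`, squad K2, ENGINE E1 (campaign «EIS-WHITTAKER-3», rung W3₃).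
THEOREMS ONLY (no `def`, no instance, no notation, no `sorry`; default heartbeats); lane `--supports stmt-HodgeConjecture-24833 --as helper` (count-neutral).  `L` CM, `c` complex
conjugation, `δ ∈ L⁻ ∖ 0`, `δ² = d`; `v` a finite place of `L⁺`, `w ∣ v`, `ι_w = toPlace v w : L⁺_v →+* L_w`, `ψ_{L,w} = adeleAddCharAt L w` (Tate's local character of `L`),
`χ_w := ψ_{L,w} ∘ ι_w` — written out as `(adeleAddCharAt L w.1).compAddMonoidHom (toPlace v w).toAddMonoidHom : AddChar (L⁺_v) Circle` (no `def`).  These are the characters `ψ₁, ψ₂` at which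
★ B-inert `K2E1WhittakerLocalMeanInertU3.integral_whittakerInertCell_pi_eq` and ★ B-split `K2E1WhittakerLocalMeanSplitU3.integral_whittakerSplitCell_pi_eq` are instantiated in (U3C-c3).
* §1 `continuous_charComp`, `charComp_eq_one_of_valued_le_one` (`ψ_{L,w}` is trivial on `𝒪_w` ★, `ι_w(𝒪_v) ⊆ 𝒪_w` ★).
* §2 NON-SPLIT `w` (`c • w = w`): **`adeleAddCharAt_toPlace_mul_delta_eq_one`** `ψ_{L,w}(ι_w(x)·δ_w) = 1` for EVERY `x ∈ L⁺_v` (with `z = ι_w(x∕2)·δ_w`: `σ_w z = −z` ★, `ψ_w ∘ σ_w = ψ_w` ★, so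
  `ψ_w(z) = ψ_w(z)⁻¹`, `ψ_w(2z) = 1`); **`adeleAddCharAt_quadraticLocalEquiv_mul_apply`** `ψ_{L,w}(Ψ_v(a,b)_w·Ψ_v(p,q)_w) = χ_w(p·a)·χ_w(q·(d·b))` — the character of ★ B1's token
  `W_v(ξ,z)` at a non-split `v` IS ★ B-inert's `ψ₁(q₀ξ₁)·ψ₂(q₁ξ₂)` with `ψ₁ = ψ₂ = χ_w`, `(ξ₁, ξ₂) = (a, d·b)` the `{1, δ}`-coordinates data of `ξ_w = Ψ_v(a,b)_w`.
* §3 **`eventually_hasConductorExp_zero_charComp`**: `∀ᶠ v, ∀ w ∣ v, χ_w.HasConductorExp 0` (★ `eventually_exists_adeleAddCharAt_ne_one` for `L`, regrouped along `L⁺` ★; off `v ∣ 2` and the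
  ramified `v`: at a non-split `w` the witness is symmetrised `y' = z + σ_w z` (`ψ_w(y') = ψ_w(2z) ≠ 1`) and descends to `L⁺_v` ★; at a split `w` it descends along `ι_w` ★ `toPlace_splitCoord`).
HONEST LABEL: HC_CM is proved only modulo the 7 printed citations (2 remaining named inputs: hLiu418 = `stmt-HodgeConjecture-24832`, h413 = `stmt-HodgeConjecture-24833`) until rung 0
closes; this file asserts no named fact and closes no socket; count-neutral; unconditional local algebra.

## References
* [TateThesis1967] J. Tate, *Fourier analysis in number fields and Hecke's zeta-functions* (1967): §2.2 (local additive characters and their conductors), Lemma 4.1.5.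
* [CasselsFrohlichANT1967] J. W. S. Cassels, A. Fröhlich (eds.), *Algebraic Number Theory* (1967): Ch. II §10–§14, Ch. VII §1.1.
* [Rogawski1990] J. D. Rogawski, *Automorphic Representations of Unitary Groups in Three Variables* (1990): §4.5.
-/

set_option autoImplicit false
set_option linter.dupNamespace false -- the mandated namespace repeats `HodgeConjecture.HodgeConjecture`

noncomputable section

open NumberField IsDedekindDomain Filter
open scoped NNReal
open Literature.NumberTheory.Automorphic Literature.NumberTheory.Automorphic.UnitaryGroup Literature.NumberTheory.GaloisRepresentations
open Literature.NumberTheory.GaloisRepresentations.IsNonarchimedeanLocalField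

namespace Summit.HodgeConjecture.HodgeConjecture.Cruxes.H413.K2E1WhittakerLocalCharactersCM

variable (L : Type) [Field L] [NumberField L] [IsCMField L] (v : HeightOneSpectrum (𝓞 ↥(maximalRealSubfield L))) (w : PlacesOver L v)

/-! ## §1 The characters `χ_w = ψ_{L,w} ∘ ι_w` of `L⁺_v` -/

omit [IsCMField L] in
/-- `χ_w = ψ_{L,w} ∘ ι_w` is continuous. [folklore] -/
theorem continuous_charComp :
    Continuous ((adeleAddCharAt L w.1).compAddMonoidHom (toPlace v w : v.adicCompletion ↥(maximalRealSubfield L) →+* w.1.adicCompletion L).toAddMonoidHom) :=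
  (continuous_adeleAddCharAt L w.1).comp (continuous_toPlace v w)

omit [IsCMField L] in
/-- Unfolding: `χ_w x = ψ_{L,w}(ι_w x)`. [folklore] -/
theorem charComp_apply (x : v.adicCompletion ↥(maximalRealSubfield L)) :
    (adeleAddCharAt L w.1).compAddMonoidHom (toPlace v w : v.adicCompletion ↥(maximalRealSubfield L) →+* w.1.adicCompletion L).toAddMonoidHom x =
      adeleAddCharAt L w.1 (toPlace v w x) := rfl

omit [IsCMField L] in
/-- **`χ_w` IS TRIVIAL ON `𝒪_v`** (`ψ_{L,w}` is trivial on `𝒪_w` ★ `adeleAddCharAt_eq_one_of_mem`; `ι_w 𝒪_v ⊆ 𝒪_w` ★). [cite: TateThesis1967, §2.2] -/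
theorem charComp_eq_one_of_valued_le_one {x : v.adicCompletion ↥(maximalRealSubfield L)} (hx : Valued.v x ≤ 1) :
    (adeleAddCharAt L w.1).compAddMonoidHom (toPlace v w : v.adicCompletion ↥(maximalRealSubfield L) →+* w.1.adicCompletion L).toAddMonoidHom x = 1 := by
  rw [charComp_apply]
  exact adeleAddCharAt_eq_one_of_mem L w.1 ((HeightOneSpectrum.mem_adicCompletionIntegers (𝓞 L) L w.1).2 ((valued_toPlace_le_one_iff w x).2 hx))

/-! ## §2 Non-split places: `ψ_{L,w}` kills the skew line `ι_w(L⁺_v)·δ_w`, and the character of ★ B1's token factors through `χ_w` -/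

section NonSplit

variable {δ : L} (hcδ : IsCMField.complexConj L δ = -δ)

include hcδ in
/-- **`ψ_{L,w}(ι_w(x)·δ_w) = 1` FOR EVERY `x ∈ L⁺_v` AT A NON-SPLIT `w`**: for `z = ι_w(x∕2)·δ_w` one has `σ_w z = −z` (`σ_w` fixes `ι_w` ★ and `σ_w δ = −δ` ★) and `ψ_w(σ_w z) = ψ_w(z)` ★, so
`ψ_w(z) = ψ_w(−z) = ψ_w(z)⁻¹`, whence `ψ_w(ι_w(x)·δ_w) = ψ_w(2z) = ψ_w(z)² = 1`. [cite: TateThesis1967, §2.2] [cite: CasselsFrohlichANT1967, Ch. VII §1.1] -/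
theorem adeleAddCharAt_toPlace_mul_delta_eq_one (hw : IsCMField.complexConj L • w.1 = w.1) (x : v.adicCompletion ↥(maximalRealSubfield L)) :
    adeleAddCharAt L w.1 (toPlace v w x * algebraMap L (w.1.adicCompletion L) δ) = 1 := by
  set z : w.1.adicCompletion L := toPlace v w (2⁻¹ * x) * algebraMap L (w.1.adicCompletion L) δ with hz
  have hσδ : galAdicCompletionMap (L := L) (IsCMField.complexConj L) hw (algebraMap L (w.1.adicCompletion L) δ) = -algebraMap L (w.1.adicCompletion L) δ := by
    have h := galAdicCompletionMap_coe_algEquiv (σ := IsCMField.complexConj L) (h := hw) (x := δ)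
    rw [hcδ] at h
    exact h.trans (map_neg (algebraMap L (w.1.adicCompletion L)) δ)
  have hσz : galAdicCompletionMap (L := L) (IsCMField.complexConj L) hw z = -z := by
    rw [hz, map_mul, galAdicCompletionMap_toPlace (IsCMField.complexConj L) w w hw, hσδ, mul_neg]
  have hψ : adeleAddCharAt L w.1 z = adeleAddCharAt L w.1 (-z) := by
    rw [← hσz, adeleAddCharAt_galAdicCompletionMap]
  have h2z : toPlace v w x * algebraMap L (w.1.adicCompletion L) δ = z + z := by
    rw [hz, ← add_mul, ← map_add, ← two_mul, ← mul_assoc, mul_inv_cancel₀ (two_ne_zero), one_mul]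
  have hsq : adeleAddCharAt L w.1 z * adeleAddCharAt L w.1 z = 1 := by
    rw [show adeleAddCharAt L w.1 z * adeleAddCharAt L w.1 z = adeleAddCharAt L w.1 z * adeleAddCharAt L w.1 (-z) by rw [← hψ],
      ← AddChar.map_add_eq_mul, add_neg_cancel, AddChar.map_zero_eq_one]
  rw [h2z, AddChar.map_add_eq_mul, hsq]

variable (hδ : δ ≠ 0) {d : ↥(maximalRealSubfield L)} (hd : δ * δ = algebraMap ↥(maximalRealSubfield L) L d)

include hd in
omit [IsCMField L] in
/-- `δ_w² = ι_w d` in `L_w`. [folklore] -/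
theorem delta_mul_delta_eq_toPlace :
    algebraMap L (w.1.adicCompletion L) δ * algebraMap L (w.1.adicCompletion L) δ = toPlace v w (d : v.adicCompletion ↥(maximalRealSubfield L)) := by
  rw [← map_mul, hd, toPlace_coe]
  rfl

include hcδ hd in
/-- **THE CHARACTER OF ★ B1's TOKEN AT A NON-SPLIT PLACE FACTORS THROUGH `χ_w`**: for all `a b p q ∈ L⁺_v`,
`ψ_{L,w}(Ψ_v(a,b)_w · Ψ_v(p,q)_w) = χ_w(p·a) · χ_w(q·(d·b))` (`Ψ_v(a,b)·Ψ_v(p,q) = Ψ_v(ap + dbq, aq + bp)`, and the skew part dies by `adeleAddCharAt_toPlace_mul_delta_eq_one`) — ★ B-inert's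
`ψ₁(q₀ξ₁)·ψ₂(q₁ξ₂)` with `ψ₁ = ψ₂ = χ_w`, `ξ₁ = a`, `ξ₂ = d·b`. [cite: Rogawski1990, §4.5] [cite: CasselsFrohlichANT1967, Ch. II §10] -/
theorem adeleAddCharAt_quadraticLocalEquiv_mul_apply (hw : IsCMField.complexConj L • w.1 = w.1) (a b p q : v.adicCompletion ↥(maximalRealSubfield L)) :
    adeleAddCharAt L w.1 (quadraticLocalEquiv L v (IsCMField.complexConj L) hcδ hδ (a, b) w * quadraticLocalEquiv L v (IsCMField.complexConj L) hcδ hδ (p, q) w) =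
      (adeleAddCharAt L w.1).compAddMonoidHom (toPlace v w : v.adicCompletion ↥(maximalRealSubfield L) →+* w.1.adicCompletion L).toAddMonoidHom (p * a) *
        (adeleAddCharAt L w.1).compAddMonoidHom (toPlace v w : v.adicCompletion ↥(maximalRealSubfield L) →+* w.1.adicCompletion L).toAddMonoidHom (q * (d * b)) := by
  haveI : Algebra.IsQuadraticExtension ↥(maximalRealSubfield L) L := IsCMField.isQuadraticExtension L
  have hmul : quadraticLocalEquiv L v (IsCMField.complexConj L) hcδ hδ (a, b) w * quadraticLocalEquiv L v (IsCMField.complexConj L) hcδ hδ (p, q) w =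
      toPlace v w (p * a + q * (d * b)) + toPlace v w (a * q + b * p) * algebraMap L (w.1.adicCompletion L) δ := by
    rw [K2E1IntertwiningLocalFactorU3Height.quadraticLocalEquiv_apply_place L (IsCMField.complexConj L) hcδ hδ v w,
      K2E1IntertwiningLocalFactorU3Height.quadraticLocalEquiv_apply_place L (IsCMField.complexConj L) hcδ hδ v w, Pi.algebraMap_apply]
    have hδδ := delta_mul_delta_eq_toPlace L v w hd
    simp only [map_add, map_mul]
    linear_combination (toPlace v w b * toPlace v w q) * hδδ
  rw [hmul, AddChar.map_add_eq_mul, adeleAddCharAt_toPlace_mul_delta_eq_one L v w hcδ hw, mul_one, map_add, AddChar.map_add_eq_mul]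
  rfl

end NonSplit

/-! ## §3 Conductor exponent `0` at almost every place -/

section Conductor

variable {δ : L} (hcδ : IsCMField.complexConj L δ = -δ) (hδ : δ ≠ 0) {d : ↥(maximalRealSubfield L)} (hd : δ * δ = algebraMap ↥(maximalRealSubfield L) L d)

include hcδ hδ hd in
/-- **`χ_w` HAS CONDUCTOR EXPONENT `0` FOR ALL `w ∣ v`, FOR ALL BUT FINITELY MANY `v`** (trivial on `𝒪_v` everywhere, §1; non-trivial on `𝔭_v⁻¹` as soon as `ψ_{L,w}` is non-trivial on
`𝔭_w⁻¹` for every `w ∣ v` ★, `|2|_v = 1` and `v` is unramified in `L` ★ — at a non-split `w` the witness `y` is replaced by the `σ_w`-fixed `2⁻¹y + σ_w(2⁻¹y)`, which descends to `L⁺_v` ★ and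
has `ψ_w`-value `ψ_w(y) ≠ 1`; at a split `w` it descends along the bijection `ι_w` ★ `toPlace_surjective` (the letters `hcδ hδ hd` only feed that bijection)).
[cite: TateThesis1967, §2.2, Lemma 4.1.5] [cite: CasselsFrohlichANT1967, Ch. VII §1.1] -/
theorem eventually_hasConductorExp_zero_charComp :
    ∀ᶠ v : HeightOneSpectrum (𝓞 ↥(maximalRealSubfield L)) in cofinite, ∀ w : PlacesOver L v,
      ((adeleAddCharAt L w.1).compAddMonoidHom (toPlace v w : v.adicCompletion ↥(maximalRealSubfield L) →+* w.1.adicCompletion L).toAddMonoidHom).HasConductorExp 0 := by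
  haveI : Algebra.IsQuadraticExtension ↥(maximalRealSubfield L) L := IsCMField.isQuadraticExtension L
  have hc1 : IsCMField.complexConj L ≠ 1 := IsCMField.complexConj_ne_one L
  -- the three cofinite conditions
  have h1 := eventually_forall_placesOver (F := ↥(maximalRealSubfield L)) (E := L) (eventually_exists_adeleAddCharAt_ne_one L)
  have h2 : ∀ᶠ v : HeightOneSpectrum (𝓞 ↥(maximalRealSubfield L)) in cofinite, Valued.v (2 : v.adicCompletion ↥(maximalRealSubfield L)) = 1 := by
    filter_upwards [eventually_valued_algebraMap_eq_one (E := ↥(maximalRealSubfield L)) (two_ne_zero : (2 : ↥(maximalRealSubfield L)) ≠ 0)] with v hv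
    rwa [map_ofNat] at hv
  have h3 : ∀ᶠ v : HeightOneSpectrum (𝓞 ↥(maximalRealSubfield L)) in cofinite, Algebra.IsUnramifiedIn (𝓞 L) v.asIdeal :=
    Filter.eventually_cofinite.2 (Literature.NumberTheory.GaloisRepresentations.finite_setOf_not_isUnramifiedIn ↥(maximalRealSubfield L) L)
  filter_upwards [h1, h2, h3] with v hv1 hv2 hv3 w
  refine ⟨fun x hx => charComp_eq_one_of_valued_le_one L v w (by simpa using ((mem_primePowBall_adicCompletion_iff v).1 hx)), ?_⟩
  obtain ⟨y, hyv, hyψ⟩ := hv1 w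
  have he := Literature.NumberTheory.NumberFields.ramificationIdx'_eq_one_of_isUnramifiedIn L v w hv3
  by_cases hw : IsCMField.complexConj L • w.1 = w.1
  · -- non-split: symmetrise and descend
    set z : w.1.adicCompletion L := 2⁻¹ * y with hz
    have h2w : Valued.v (2 : w.1.adicCompletion L) = 1 := by
      have h := Literature.NumberTheory.NumberFields.valued_toPlace_of_ramificationIdx'_eq_one L v w he 2
      rw [map_ofNat] at h
      rw [h, hv2]
    have hzv : Valued.v z ≤ WithZero.exp (1 : ℤ) := by
      rw [hz, map_mul, map_inv₀, h2w, inv_one, one_mul]; exact hyv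
    set y' := z + galAdicCompletionMap (L := L) (IsCMField.complexConj L) hw z with hy'
    have hfix : galAdicCompletionMap (L := L) (IsCMField.complexConj L) hw y' = y' := by
      rw [hy', map_add, galAdicCompletionMap_galAdicCompletionMap_of_smul_eq (IsCMField.complexConj L) w hc1 hw, add_comm]
    obtain ⟨p, hp⟩ := exists_toPlace_eq_of_galAdicCompletionMap_eq (IsCMField.complexConj L) w hc1 hw y' hfix
    refine ⟨p, ?_, ?_⟩
    · rw [mem_primePowBall_adicCompletion_iff v, zero_sub, neg_neg,
        ← Literature.NumberTheory.NumberFields.valued_toPlace_of_ramificationIdx'_eq_one L v w he p, hp, hy']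
      refine (Valued.v.map_add _ _).trans (max_le hzv ?_)
      rw [valued_galAdicCompletionMap]
      exact hzv
    · rw [charComp_apply, hp, hy', AddChar.map_add_eq_mul, adeleAddCharAt_galAdicCompletionMap, ← AddChar.map_add_eq_mul, hz,
        ← two_mul, ← mul_assoc, mul_inv_cancel₀ two_ne_zero, one_mul]
      exact hyψ
  · -- split: descend along the bijection `ι_w`
    obtain ⟨p, hp⟩ := Literature.NumberTheory.GelbartRogawski1991.UnitaryDualPair.LocalSplitting.toPlace_surjective ↥(maximalRealSubfield L) L (IsCMField.complexConj L) hcδ hδ hd v w hw y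
    refine ⟨p, ?_, ?_⟩
    · rw [mem_primePowBall_adicCompletion_iff v, zero_sub, neg_neg,
        ← Literature.NumberTheory.GelbartRogawski1991.UnitaryDualPair.LocalSplitting.valued_toPlace_of_split ↥(maximalRealSubfield L) L (IsCMField.complexConj L) v w hw p, hp]
      exact hyv
    · rw [charComp_apply, hp]
      exact hyψ

end Conductor

end Summit.HodgeConjecture.HodgeConjecture.Cruxes.H413.K2E1WhittakerLocalCharactersCM

end
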